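import Summits.ValiantsHypothesis.ValiantsHypothesis.Theorems.BI17LatinCubesAdmissibleTables
import HarnessLib

/-!
# Latin cubes are admissible tables — part 2: the sign formula, the signed counts, and the consequences

PART 2 of 2 of val-lit-t03 g6's file (see the module docstring of
`BI17LatinCubesAdmissibleTables.lean`, part 1, for the full account, references and honest framing):

* the fixed twist `(a, (b, z)) ↦ (b, (a, z))` of `[n] × [n²]` and its sign (`sign_twist`);
* the sign formula `latinCubeSign_cubeOfTable : latinCubeSign n (cubeOfTable S T) =
  sign (twist n) · (rsgn S · rsgn T · csgn (S,T))`;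
* the inverse laws `cubeOfTable_tableOfCube`, `tableOfCube_cubeOfTable` (Latin cubes of size `n` ARE
  admissible `n`-tables);
* `latinCubeCount_eq_sign_twist_mul_admissibleTableCount`, `latinCubeCount_eq_admissibleTableCount_of_even`,
  `latinCubeCount_ne_zero_iff`;
* consequences: `fundInvariantTensor_unitTensor_eq_cayleyP_det` (`F_n(⟨n²⟩) = ± (n!)^{n²} P_{n,n²}(det_n)`),
  `latinCubeQuestion_iff_minimalDegree_det` (BI Problem 5.23 ⟺ `e(det_n) = n²`, `n ≥ 2`),
  `latinCubeQuestion_iff_cayleyP_det_ne_zero`; edges `BI2017_latinCube_2_4_iff_admissibleTableCount_four`,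
  `BI2017_latinCube_2_4_iff_cayleyP_det_four`, `BI2017_latinCube_2_4_of_P416`,
  `minimalDegree_det_four_of_latinCube` — the two computational facts of the tree
  (`BI2017_latinCube_2_4`, the `det` half of `BI2017_P416_det_per`) are ONE open computation.

Theorem-only apart from the three plumbing defs `splitEquiv`, `twist₀`, `twist` (with bodies); no named
facts, no instances, no notation. Honest framing: elementary bookkeeping inside BI 2017's toy invariants
(§3.3 Prop. 3.28 / eq. (3.9); §5.2 Def. 5.21, Prop. 5.22, Problem 5.23); VP ≠ VNP is NOT proved and
nothing here is progress on it. Typed by val-lit-t03 g6 (unit val-lit-t03-g6); filed verbatim (split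
only) by prover val-lit-p4 g5 (lead-bip RULINGS #19 (3)).

## References
* [BurgisserIkenmeyer2017] P. Bürgisser, C. Ikenmeyer, *Fundamental invariants of orbit closures*,
  J. Algebra 477 (2017) 390–434, §3.3 Prop. 3.28 / eq. (3.9); §5.2 Def. 5.21, Prop. 5.22, Problem 5.23.
-/

namespace Summit.ValiantsHypothesis.BI17LatinCubesAdmissibleTables

open Finset Equiv Literature.Computability.AlgebraicComplexity

variable {n : ℕ}

/-! ### The fixed twist `(a, (b, z)) ↦ (b, (a, z))` of `[n] × [n²]` and its sign -/

/-- `[n] × [n²] ≃ [n] × ([n] × [n])` through `finProdFinEquiv`. [folklore] -/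
def splitEquiv (n : ℕ) : Fin n × Fin (n * n) ≃ Fin n × (Fin n × Fin n) :=
  Equiv.prodCongr (Equiv.refl _) finProdFinEquiv.symm

/-- The coordinate twist `(c, (r, z)) ↦ (r, (c, z))` of `[n] × ([n] × [n])`. [folklore] -/
def twist₀ (n : ℕ) : Equiv.Perm (Fin n × (Fin n × Fin n)) :=
  (Equiv.prodAssoc (Fin n) (Fin n) (Fin n)).symm.trans
    ((Equiv.prodCongr (Equiv.prodComm (Fin n) (Fin n)) (Equiv.refl (Fin n))).trans
      (Equiv.prodAssoc (Fin n) (Fin n) (Fin n)))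

/-- The twist `(a, e(b, z)) ↦ (b, e(a, z))` of `[n] × [n²]` (`e = finProdFinEquiv`): the fixed
permutation relating the `x`-positions and the `y`-positions of the symbols. [folklore] -/
def twist (n : ℕ) : Equiv.Perm (Fin n × Fin (n * n)) :=
  (splitEquiv n).trans ((twist₀ n).trans (splitEquiv n).symm)

/-- The twist on split coordinates. [folklore] -/
theorem twist_apply (a b z : Fin n) :
    twist n (a, finProdFinEquiv (b, z)) = (b, finProdFinEquiv (a, z)) := by
  simp [twist, twist₀, splitEquiv]

/-- `sign(twist) = sign(prodComm on [n]×[n])^n` (stated in `ℤ`: the `ℕ`-power on `ℤˣ` elaborates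
through the `ℤˣ`-module instance, not `Monoid.npow`). [folklore] -/
theorem sign_twist (n : ℕ) :
    ((Equiv.Perm.sign (twist n) : ℤˣ) : ℤ) =
      ((Equiv.Perm.sign (Equiv.prodComm (Fin n) (Fin n)) : ℤˣ) : ℤ) ^ n := by
  have h1 : Equiv.Perm.sign (twist n) = Equiv.Perm.sign (twist₀ n) := by
    rw [twist, Equiv.Perm.sign_trans_trans, Equiv.self_trans_symm, Equiv.Perm.sign_refl, mul_one]
  have h2 : Equiv.Perm.sign (twist₀ n) =
      Equiv.Perm.sign (Equiv.prodCongr (Equiv.prodComm (Fin n) (Fin n)) (Equiv.refl (Fin n))) := by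
    rw [twist₀, Equiv.Perm.sign_trans_trans, Equiv.symm_trans_self, Equiv.Perm.sign_refl, mul_one]
  have h3 : (Equiv.prodCongr (Equiv.prodComm (Fin n) (Fin n)) (Equiv.refl (Fin n)) :
      Equiv.Perm ((Fin n × Fin n) × Fin n)) =
      Equiv.prodCongrLeft fun _ : Fin n => Equiv.prodComm (Fin n) (Fin n) := by
    ext ⟨x, z⟩ <;> rfl
  rw [h1, h2, h3, Equiv.Perm.sign_prodCongrLeft, Finset.prod_const, Finset.card_univ,
    Fintype.card_fin, Units.val_pow_eq_pow_val]

section Table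

variable {S T : Fin (n * n) → Fin n → Fin n} (h : IsAdmissibleTable S T)
include h

/-- **Key identity**: the `x`-position permutation factors as twist ∘ `y`-positions ∘ patterns. [folklore] -/
theorem prodCongrRight_posX :
    (Equiv.prodCongrRight (posX h) : Equiv.Perm (Fin n × Fin (n * n))) =
      twist n * (Equiv.prodCongrRight (posY h) * Equiv.prodCongrLeft (pat h)) := by
  refine Equiv.ext fun ⟨r, i⟩ => ?_
  rw [Equiv.Perm.mul_apply, Equiv.Perm.mul_apply, Equiv.prodCongrLeft_apply,
    Equiv.prodCongrRight_apply, Equiv.prodCongrRight_apply]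
  set z := (rowPermS h i).symm r with hz
  have hSz : S i z = r := Equiv.ofBijective_apply_symm_apply (S i) (h.1 i) r
  have hpat : pat h i r = T i z := rfl
  have hw : (rowPermT h i).symm (T i z) = z :=
    Equiv.ofBijective_symm_apply_apply (T i) (h.2.1 i) z
  rw [hpat]
  show (r, finProdFinEquiv (T i z, z)) =
    twist n (T i z, finProdFinEquiv (S i ((rowPermT h i).symm (T i z)), (rowPermT h i).symm (T i z)))
  rw [hw, hSz, twist_apply]

/-- `sgn_x · sgn_y = sign(twist) · ∏_i sgn(π_i)`. [folklore] -/
theorem labelSignX_mul_labelSignY :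
    labelSignX n (cubeOfTable S T) * labelSignY n (cubeOfTable S T) =
      ((Equiv.Perm.sign (twist n) * ∏ i, Equiv.Perm.sign (pat h i) : ℤˣ) : ℤ) := by
  rw [labelSignX_cubeOfTable h, labelSignY_cubeOfTable h, ← Units.val_mul]
  congr 1
  rw [← Equiv.Perm.sign_prodCongrRight, ← Equiv.Perm.sign_prodCongrRight, prodCongrRight_posX h,
    Equiv.Perm.sign_mul, Equiv.Perm.sign_mul, ← Equiv.Perm.sign_prodCongrLeft]
  set a := Equiv.Perm.sign (twist n)
  set b := Equiv.Perm.sign (Equiv.prodCongrRight (posY h) : Equiv.Perm (Fin n × Fin (n * n)))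
  set c := Equiv.Perm.sign (Equiv.prodCongrLeft (pat h) : Equiv.Perm (Fin n × Fin (n * n)))
  show a * (b * c) * b = a * c
  rw [mul_assoc a (b * c) b, mul_comm b c, mul_assoc c b b, Int.units_mul_self, mul_one]

/-- **The sign of the Latin cube of an admissible table**:
`sgn(α_{S,T}) = sign(twist_n) · rsgn(S) rsgn(T) csgn(S,T)`. [folklore] -/
theorem latinCubeSign_cubeOfTable :
    latinCubeSign n (cubeOfTable S T) =
      ((Equiv.Perm.sign (twist n) : ℤˣ) : ℤ) *
        ((tableRowSign S * tableRowSign T * tableColSign S T : ℤˣ) : ℤ) := by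
  rw [latinCubeSign, labelSignX_mul_labelSignY h, labelSignZ_cubeOfTable h,
    tableRowSign_mul_tableRowSign h, ← Units.val_mul, ← Units.val_mul, mul_assoc]

end Table

/-! ### From a Latin cube back to its table -/

section Cube

variable {α : Fin n × Fin n × Fin n → Fin (n * n)} (hα : IsLatinCube n α)
include hα

/-- Unfolding `tableOfCube` on a Latin cube (first table). [folklore] -/
theorem tableOfCube_fst (i : Fin (n * n)) (z : Fin n) :
    (tableOfCube n α).1 i z =
      (finProdFinEquiv.symm ((Equiv.ofBijective _ (hα.2.2 z)).symm i)).1 := by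
  simp only [tableOfCube, dif_pos (hα.2.2 z)]

/-- Unfolding `tableOfCube` on a Latin cube (second table). [folklore] -/
theorem tableOfCube_snd (i : Fin (n * n)) (z : Fin n) :
    (tableOfCube n α).2 i z =
      (finProdFinEquiv.symm ((Equiv.ofBijective _ (hα.2.2 z)).symm i)).2 := by
  simp only [tableOfCube, dif_pos (hα.2.2 z)]

/-- The symbol `i` sits at `(S(i,z), T(i,z), z)`. [folklore] -/
theorem apply_tableOfCube (i : Fin (n * n)) (z : Fin n) :
    α ((tableOfCube n α).1 i z, (tableOfCube n α).2 i z, z) = i := by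
  rw [tableOfCube_fst hα, tableOfCube_snd hα]
  exact Equiv.ofBijective_apply_symm_apply (zSliceMap n α z) (hα.2.2 z) i

/-- … and nowhere else in the `z`-slice. [folklore] -/
theorem tableOfCube_eq_of {r c z : Fin n} {i : Fin (n * n)} (hi : α (r, c, z) = i) :
    (tableOfCube n α).1 i z = r ∧ (tableOfCube n α).2 i z = c := by
  have hq : (Equiv.ofBijective _ (hα.2.2 z)).symm i = finProdFinEquiv (r, c) := by
    rw [Equiv.symm_apply_eq]
    show i = zSliceMap n α z (finProdFinEquiv (r, c))
    simp [zSliceMap, hi]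
  rw [tableOfCube_fst hα, tableOfCube_snd hα, hq]
  simp

/-- The table of a Latin cube is admissible. [folklore] -/
theorem isAdmissibleTable_tableOfCube :
    IsAdmissibleTable (tableOfCube n α).1 (tableOfCube n α).2 := by
  refine ⟨fun i => ?_, fun i => ?_, fun z => ?_⟩
  · -- rows of `S`: symbol `i` meets each `x`-slice once
    refine Finite.injective_iff_bijective.mp fun z₁ z₂ hz => ?_
    have h₁ := apply_tableOfCube hα i z₁
    have h₂ := apply_tableOfCube hα i z₂
    set r := (tableOfCube n α).1 i z₁
    have e₁ : xSliceMap n α r (finProdFinEquiv ((tableOfCube n α).2 i z₁, z₁)) = i := by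
      simp [xSliceMap, h₁]
    have e₂ : xSliceMap n α r (finProdFinEquiv ((tableOfCube n α).2 i z₂, z₂)) = i := by
      simp only [xSliceMap, Equiv.symm_apply_apply]; rw [hz]; exact h₂
    have := (hα.1 r).1 (e₁.trans e₂.symm)
    exact (Prod.mk.inj (finProdFinEquiv.injective this)).2
  · -- rows of `T`: symbol `i` meets each `y`-slice once
    refine Finite.injective_iff_bijective.mp fun z₁ z₂ hz => ?_
    have h₁ := apply_tableOfCube hα i z₁
    have h₂ := apply_tableOfCube hα i z₂
    set c := (tableOfCube n α).2 i z₁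
    have e₁ : ySliceMap n α c (finProdFinEquiv ((tableOfCube n α).1 i z₁, z₁)) = i := by
      simp [ySliceMap, h₁]
    have e₂ : ySliceMap n α c (finProdFinEquiv ((tableOfCube n α).1 i z₂, z₂)) = i := by
      simp only [ySliceMap, Equiv.symm_apply_apply]; rw [hz]; exact h₂
    have := (hα.2.1 c).1 (e₁.trans e₂.symm)
    exact (Prod.mk.inj (finProdFinEquiv.injective this)).2
  · -- columns: the inverse of the `z`-slice bijection
    have : (fun i => ((tableOfCube n α).1 i z, (tableOfCube n α).2 i z)) =
        ⇑finProdFinEquiv.symm ∘ ⇑(Equiv.ofBijective _ (hα.2.2 z)).symm := by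
      funext i
      simp only [tableOfCube_fst hα, tableOfCube_snd hα, Function.comp_apply, Prod.mk.eta]
    rw [this]
    exact finProdFinEquiv.symm.bijective.comp (Equiv.ofBijective _ (hα.2.2 z)).symm.bijective

/-- Right inverse: the cube of the table of a Latin cube is the cube. [folklore] -/
theorem cubeOfTable_tableOfCube : cubeOfTable (tableOfCube n α).1 (tableOfCube n α).2 = α := by
  funext ⟨r, c, z⟩
  have h2 := tableOfCube_eq_of hα (rfl : α (r, c, z) = α (r, c, z))
  exact cubeOfTable_eq_of (isAdmissibleTable_tableOfCube hα) h2.1 h2.2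

end Cube

/-- Left inverse: the table of the cube of an admissible table is the table. [folklore] -/
theorem tableOfCube_cubeOfTable {S T : Fin (n * n) → Fin n → Fin n} (h : IsAdmissibleTable S T) :
    tableOfCube n (cubeOfTable S T) = (S, T) := by
  have hL := isLatinCube_cubeOfTable h
  refine Prod.ext (funext fun i => funext fun z => ?_) (funext fun i => funext fun z => ?_)
  · exact (tableOfCube_eq_of hL (cubeOfTable_eq_of h (i := i) (z := z) rfl rfl)).1
  · exact (tableOfCube_eq_of hL (cubeOfTable_eq_of h (i := i) (z := z) rfl rfl)).2

/-! ### The signed counts agree -/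

/-- **Latin cubes of size `n` ARE the admissible `n`-tables, with signs agreeing up to the fixed sign
`sign(twist_n) = sign(swap on [n]×[n])^n`:**
`#{even} − #{odd Latin cubes} = sign(twist_n) · (#{even} − #{odd admissible n-tables})`.
[folklore] (the observation of this file; BI 2017 treat Prop. 3.28 and Problem 5.23 separately) -/
theorem latinCubeCount_eq_sign_twist_mul_admissibleTableCount (n : ℕ) :
    latinCubeCount n =
      ((Equiv.Perm.sign (twist n) : ℤˣ) : ℤ) * admissibleTableCount n := by
  classical
  rw [latinCubeCount, admissibleTableCount, Finset.mul_sum]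
  symm
  refine Finset.sum_nbij' (fun ST => cubeOfTable ST.1 ST.2) (fun α => tableOfCube n α) ?_ ?_ ?_ ?_ ?_
  · intro ST hST
    simp only [Finset.mem_filter, Finset.mem_univ, true_and] at hST ⊢
    exact isLatinCube_cubeOfTable hST
  · intro α hα
    simp only [Finset.mem_filter, Finset.mem_univ, true_and] at hα ⊢
    exact isAdmissibleTable_tableOfCube hα
  · intro ST hST
    simp only [Finset.mem_filter, Finset.mem_univ, true_and] at hST
    exact tableOfCube_cubeOfTable hST
  · intro α hα
    simp only [Finset.mem_filter, Finset.mem_univ, true_and] at hα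
    exact cubeOfTable_tableOfCube hα
  · intro ST hST
    simp only [Finset.mem_filter, Finset.mem_univ, true_and] at hST
    exact (latinCubeSign_cubeOfTable hST).symm

/-- The sign is `sign(swap)^n`, hence `+1` for every even `n`. [folklore] -/
theorem latinCubeCount_eq_admissibleTableCount_of_even {n : ℕ} (hn : Even n) :
    latinCubeCount n = admissibleTableCount n := by
  rw [latinCubeCount_eq_sign_twist_mul_admissibleTableCount, sign_twist]
  rcases Int.units_eq_one_or (Equiv.Perm.sign (Equiv.prodComm (Fin n) (Fin n))) with h | h
  · rw [h, Units.val_one, one_pow, one_mul]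
  · rw [h, Units.val_neg, Units.val_one, hn.neg_one_pow, one_mul]

/-- **Nonvanishing is the same question.** [folklore] -/
theorem latinCubeCount_ne_zero_iff (n : ℕ) : latinCubeCount n ≠ 0 ↔ admissibleTableCount n ≠ 0 := by
  rw [latinCubeCount_eq_sign_twist_mul_admissibleTableCount]
  rw [mul_ne_zero_iff]
  exact ⟨fun h => h.2, fun h => ⟨Units.ne_zero _, h⟩⟩

/-! ### Consequences: `F_n(⟨n²⟩)` versus `P_{n,n²}(det_n)`; BI Problem 5.23 ⟺ `e(det_n) = n²` -/

open MvPolynomial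

/-- **`P_{n,n²}(det_n) ≠ 0` iff the Latin-cube count is nonzero** (via BI Prop. 3.28,
`BI2017_prop_3_28_holds`). [folklore] -/
theorem cayleyP_det_ne_zero_iff_latinCubeCount_ne_zero (n : ℕ) :
    aeval (formCoeff n (detPoly (Fin n) ℂ))
        (cayleyP (k := ℂ) n (finProdFinEquiv.symm : Fin (n * n) ≃ Fin n × Fin n)) ≠ 0 ↔
      latinCubeCount n ≠ 0 := by
  rw [latinCubeCount_ne_zero_iff]
  have h328 := (BI2017_prop_3_28_holds n).1
  have hfac : ((Nat.factorial n : ℂ)) ^ (n * n) ≠ 0 :=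
    pow_ne_zero _ (Nat.cast_ne_zero.mpr (Nat.factorial_ne_zero n))
  constructor
  · intro hP hc
    rw [hc, Int.cast_zero] at h328
    exact (mul_ne_zero hfac hP) h328
  · intro hc hP
    rw [hP, mul_zero] at h328
    exact hc (by exact_mod_cast h328.symm)

/-- **`F_n(⟨n²⟩) = sign(twist_n) · (n!)^{n²} · P_{n,n²}(det_n)`** (BI Prop. 5.22 with Prop. 3.28 and
the bijection of this file). [folklore] -/
theorem fundInvariantTensor_unitTensor_eq_cayleyP_det (n : ℕ) :
    aeval (tensorPt (unitTensor ℂ (n * n))) (fundInvariantTensor n ℂ) =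
      ((Equiv.Perm.sign (twist n) : ℤˣ) : ℤ) * ((Nat.factorial n : ℂ) ^ (n * n) *
        aeval (formCoeff n (detPoly (Fin n) ℂ))
          (cayleyP (k := ℂ) n (finProdFinEquiv.symm : Fin (n * n) ≃ Fin n × Fin n))) := by
  rw [(BI2017_prop_5_22_holds n).1, (BI2017_prop_3_28_holds n).1,
    latinCubeCount_eq_sign_twist_mul_admissibleTableCount]
  push_cast
  rfl

/-- **BI 2017 Problem 5.23 ⟺ `e(det_n) = n²`** (`2 ≤ n`): the number of even Latin cubes of size `n`
differs from the number of odd ones iff the fundamental invariant `P_{n,n²}` does not vanish at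
`det_n`, iff the minimal degree of `GL_{n²}·det_n` is `n²` (BI Prop. 3.25 (`BI2017_minimalDegree_det_per_holds`),
Prop. 3.28, Prop. 5.22) — two questions the source poses separately ("important for understanding
tensor border rank", §5.2; "for geometric complexity theory it would be important to know", §3.3).
[folklore] -/
theorem latinCubeQuestion_iff_minimalDegree_det {n : ℕ} (hn : 2 ≤ n) :
    latinCubeQuestion n ↔ minimalDegree n (detPoly (Fin n) ℂ) = n * n := by
  rw [latinCubeQuestion, (BI2017_minimalDegree_det_per_holds.1 n hn).1.2,
    cayleyP_det_ne_zero_iff_latinCubeCount_ne_zero]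

/-- The same with `P_{n,n²}(det_n)`. [folklore] -/
theorem latinCubeQuestion_iff_cayleyP_det_ne_zero (n : ℕ) :
    latinCubeQuestion n ↔
      aeval (formCoeff n (detPoly (Fin n) ℂ))
        (cayleyP (k := ℂ) n (finProdFinEquiv.symm : Fin (n * n) ≃ Fin n × Fin n)) ≠ 0 := by
  rw [latinCubeQuestion, cayleyP_det_ne_zero_iff_latinCubeCount_ne_zero]

/-! ### The two computational facts of the tree are one -/

/-- `BI2017_latinCube_2_4` ⟺ `#{even} ≠ #{odd admissible 4-tables}` (the `n = 2` conjunct is the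
theorem `latinCubeCount_two_ne_zero`). [folklore] -/
theorem BI2017_latinCube_2_4_iff_admissibleTableCount_four :
    BI2017_latinCube_2_4 ↔ admissibleTableCount 4 ≠ 0 := by
  rw [BI2017_latinCube_2_4, ← latinCubeCount_ne_zero_iff]
  exact ⟨fun h => h.2, fun h => ⟨latinCubeCount_two_ne_zero, h⟩⟩

/-- `BI2017_latinCube_2_4` ⟺ `P_{4,16}(det_4) ≠ 0` (the `det` half of `BI2017_P416_det_per`). [folklore] -/
theorem BI2017_latinCube_2_4_iff_cayleyP_det_four :
    BI2017_latinCube_2_4 ↔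
      aeval (formCoeff 4 (detPoly (Fin 4) ℂ))
        (cayleyP (k := ℂ) 4 (finProdFinEquiv.symm : Fin (4 * 4) ≃ Fin 4 × Fin 4)) ≠ 0 := by
  rw [cayleyP_det_ne_zero_iff_latinCubeCount_ne_zero, BI2017_latinCube_2_4]
  exact ⟨fun h => h.2, fun h => ⟨latinCubeCount_two_ne_zero, h⟩⟩

/-- **Edge**: `BI2017_P416_det_per → BI2017_latinCube_2_4`. [folklore] -/
theorem BI2017_latinCube_2_4_of_P416 (h : BI2017_P416_det_per) : BI2017_latinCube_2_4 :=
  BI2017_latinCube_2_4_iff_cayleyP_det_four.mpr h.1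

/-- **Edge**: `BI2017_latinCube_2_4 → e(det_4) = 16`. [folklore] -/
theorem minimalDegree_det_four_of_latinCube (h : BI2017_latinCube_2_4) :
    minimalDegree 4 (detPoly (Fin 4) ℂ) = 4 * 4 :=
  (latinCubeQuestion_iff_minimalDegree_det (by norm_num)).mp h.2

/-- **For every `n`: `#{even} − #{odd Latin cubes of size n} = #{even} − #{odd admissible n-tables}`**
(even `n`: the sign is `+1`; odd `n ≥ 3`: both sides vanish — `latinCubeCount_eq_zero_of_odd` and
BI Prop. 3.28 with `cayleyP_eq_zero_of_odd`; `n = 1`: the twist of a one-point set is trivial). [folklore] -/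
theorem latinCubeCount_eq_admissibleTableCount (n : ℕ) : latinCubeCount n = admissibleTableCount n := by
  rcases Nat.even_or_odd n with hn | hn
  · exact latinCubeCount_eq_admissibleTableCount_of_even hn
  · by_cases h1 : n = 1
    · subst h1
      rw [latinCubeCount_eq_sign_twist_mul_admissibleTableCount, sign_twist,
        Equiv.Perm.subsingleton_eq_refl (Equiv.prodComm (Fin 1) (Fin 1)), Equiv.Perm.sign_refl,
        Units.val_one, one_pow, one_mul]
    · have h3 : 1 < n := by
        rcases hn with ⟨k, rfl⟩
        omega
      have h2 : 2 ≤ n * n := by nlinarith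
      rw [latinCubeCount_eq_zero_of_odd hn h3]
      have h328 := (BI2017_prop_3_28_holds n).1
      rw [cayleyP_eq_zero_of_odd hn h2, map_zero, mul_zero] at h328
      exact_mod_cast h328

end Summit.ValiantsHypothesis.BI17LatinCubesAdmissibleTables
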